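import Literature.Geometry.Kaehler.ComplexTorusAlbertTypeIVFieldLefschetzGroupLinearFactors
import HarnessLib

/-!
# Milne 1999 §2 Remark 2.2, FRAME-FREE: for a complex torus whose endomorphism algebra is a CM field `K`,
# `φ₁ : V_{σ_w} × V_{σ̄_w} → ℂ` is a perfect pairing and RESTRICTION TO THE EIGENSPACES
# `M ↦ (M|V_{σ_w})_w : S(X)(ℂ) ≃* ∏_{w : InfinitePlace K} GL(V_{σ_w})` IS AN ISOMORPHISM («the map
# `α ↦ α|V₁ : U(φ)_Ω → GL(V₁)` is an isomorphism»), for every `n = dim V_σ = 2g/[K:ℚ]`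

Layer `Literature/Geometry/Kaehler`, namespace `Literature.Geometry.Kaehler.ComplexTorus`; lane `lit-hodgefound`
(Track 2 foundations library), Layer A4 (Lefschetz groups); prover seat `lit-hodgefound-p17`, generation 63,
self-proposed row g63-#6 — the intrinsic (frame-free) form, for EVERY block size `n`, of g61-#3
`ComplexTorusComplexMultiplicationLefschetzGroupLinearFactors` (`exists_mulEquiv_pi_siegelLevi_lefschetzGroupC`:
`S(X)(ℂ) = P · e⁻¹(∏_w {diag(g, ᵗg⁻¹)}) · P⁻¹ ≃* ∏_w siegelLevi`, in a unitary eigenframe `P`) and the companion of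
g63-#5 `ComplexTorusComplexMultiplicationLefschetzGroupCharacters` (the case `n = 1`: characters). Milne's Remark 2.2
makes three assertions about `V ⊗ Ω = V₁ ⊕ V₂`: (a) «`φ|V₁ × V₁ = 0 = φ|V₂ × V₂`» — in the tree
(`dotProduct_mulVec_eq_zero_of_mem_iInf_eigenspace_of_ne_conjugate`); (b) «there is a nondegenerate `Ω`-bilinear form
`φ₁ : V₁ × V₂ → Ω` such that `φ((x₁,x₂),(y₁,y₂)) = (φ₁(x₁,y₂), −φ₁(x₂,y₁))`» — HERE, §1: the pairing
`(v, v') ↦ ᵗv G_ℂ v'` between `V_{σ_w}` and `V_{σ̄_w}` is non-degenerate on both sides (the tree has the `E`-SYMMETRIC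
analogue `eq_zero_of_forall_dotProduct_mulVec_eq_zero_of_mem_iInf_eigenspace'` for totally real fields); (c) «Therefore, the map
`α ↦ α|V₁ : U(φ)_Ω → GL(V₁)` is an isomorphism» — HERE, §2: an isomorphism
`χ : S(X)(ℂ) ≃* ∏_{w : InfinitePlace K} GL(V_{σ_w})` onto the full linear groups of the eigenspaces
(`LinearMap.GeneralLinearGroup ℂ V_{σ_w}`) WITH `χ(M)_w v = M v` — no frame, no matrices of size `n` in the statement;
in particular an element of `S(X)(ℂ)` is determined by its restrictions to the `V_{σ_w}`. Built BY NAME on g61-#3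
(`exists_unitaryEigenframe`, `exists_mulEquiv_pi_siegelLevi_lefschetzGroupC`, `exists_mulEquiv_siegelLevi_generalLinearGroup`,
`mem_siegelLevi_iff`), p13's `dim V_σ · [K:ℚ] = 2g` (`ComplexTorusEndomorphismFieldEigenspaces`) and the polarised ∕
simple glue of g61-#4 `ComplexTorusAlbertTypeIVFieldLefschetzGroupLinearFactors`; Mathlib's `Matrix.toLinAlgEquiv`
(matrix of an endomorphism in a basis) and `basisOfLinearIndependentOfCardEqFinrank'`. THEOREMS ONLY (no definition, no
instance, no notation, no named fact; D-0026, net debt 0).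

## Sources, VERBATIM (held text `paper:doi-10-1215-s0012-7094-99-09620-5`, PDF page = printed page − 638)

* J. S. Milne, *Lefschetz classes on abelian varieties*, Duke Math. J. **96** (1999) 639–675. **Remark 2.2**,
  p. 647–648 (p0009 L48–L70, p0010 L5–L7): «Let `φ` be a nondegenerate skew-Hermitian form on a `k′`-vector space `V`
  relative to the nontrivial involution of `k′` fixing `k`. […] Write `V ⊗_k Ω = V₁ ⊕ V₂`, `Vᵢ = V ⊗_{k′,σᵢ} Ω` […]
  Then `φ|V₁ × V₁ = 0 = φ|V₂ × V₂`, and there is a nondegenerate `Ω`-bilinear form `φ₁ : V₁ × V₂ → Ω` such that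
  `φ((x₁, x₂), (y₁, y₂)) = (φ₁(x₁, y₂), −φ₁(x₂, y₁))` […] Therefore, the map `α ↦ α|V₁ : U(φ)_Ω → GL(V₁)` is an
  isomorphism, and the representation of `U(φ)_Ω` on `V ⊗_k Ω` becomes the direct sum of the representation of
  `GL(V₁)` on `V₁` (standard representation) and the representation of `GL(V₁)` on `V₂` (contragredient of the
  standard representation).»; «Simple abelian variety of type IV», p. 651 (p0013 L74–L82): «`S(A)_{/k^al} = ∏ S_σ`
  where `S_σ ≈ Aut_{M_d(k^al)}(V₁) ≈ GL_{g/(fd)}(k^al)`»; Prop. 2.1 (p. 646); Summary (p. 652): «IV ∣ `GL_{g/(df)}`».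
* P. Deligne, *Hodge cycles on abelian varieties* (LNM 900, 1982), I Prop. 5.1 («the Rosati involution on `E`
  defined by any polarization of `A` is complex conjugation»).
* H. Lange, *Abelian Varieties over the Complex Numbers* (2023), Lemma 2.6.6, Thm. 2.6.5, §7.2.4 Exercise (4) (`Lf(X)`).

## What is proved (CONCRETE torus level `X = E/Φ(ℤ^ι)`, `V_σ = ⨅_a Eig((f a) ⊗ 1, σ a)`, `σ_w = w.embedding`)

* §1 (b) for `f : K →ₐ[ℚ] M_ι(ℚ)` a CM field, `det G ≠ 0`, `ᵗ(f a) G = G f(ā)` (frame-free, from (a)):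
  **`eq_zero_of_mem_iInf_eigenspace_conjugate_of_forall_dotProduct_mulVec_eq_zero`** (`v' ∈ V_{σ̄_w}` orthogonal to
  `V_{σ_w}` under `ᵗv G_ℂ v'` is `0`) and `eq_zero_of_mem_iInf_eigenspace_of_forall_dotProduct_mulVec_conjugate_eq_zero`
  (the mirror statement).
* §2 (c), with moreover `f(K) = End⁰(X)`: **`exists_mulEquiv_lefschetzGroupC_pi_generalLinearGroup_eigenspace`** — an
  isomorphism `χ : S(X)(ℂ) ≃* ((w : InfinitePlace K) → GL(V_{σ_w}))` with `χ(M)_w v = M v` for `v ∈ V_{σ_w}`;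
  `eq_of_forall_mem_iInf_eigenspace_mulVec_eq` (an element of `S(X)(ℂ)` is determined by its action on the `V_{σ_w}`).
* §3 POLARISED (`IsRiemannForm`, `End⁰(X) = f(K)` a CM field): **`IsRiemannForm.exists_mulEquiv_lefschetzGroupC_pi_generalLinearGroup_eigenspace`**,
  `IsRiemannForm.exists_mulEquiv_lefschetzIdentityC_pi_generalLinearGroup_eigenspace` (Lange's `Lf(X)(ℂ) = S(X)(ℂ)`),
  and SIMPLE of Albert type IV(e₀, d = 1) through the centre `K = Z(End⁰(X))`:
  `IsSimple.exists_mulEquiv_lefschetzGroupC_pi_generalLinearGroup_eigenspace_of_isAlbertTypeIV_of_finrank_eq_one`.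

Faithfulness notes. (i) `U(φ)_Ω`, `S(A)_{/k^al}` enter through complex points, `Ω = k^al = ℂ`; for `End⁰(X) = K` (type
IV with `d = 1`) Milne's `∏_σ S_σ`, `S_σ = U(φ_σ) ≅ GL(V_{1,σ})`, is indexed by the real places of the maximal totally
real subfield, i.e. by the infinite places `w` of `K`, and `V_{1} = V_{σ_w}` for Mathlib's representative
`σ_w = w.embedding`. (ii) NOT here: the rational structure of `S(X) = U_K(φ)` (only `ℂ`-points), type IV with `d > 1`.

## References

* [Milne1999LefschetzClasses] J. S. Milne, *Lefschetz classes on abelian varieties*, Duke Math. J. 96 (1999)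
  639–675: §2 Prop. 2.1, Remark 2.2 (p. 647–648), «Simple abelian variety of type IV» (p. 651), Summary (p. 652).
* [Deligne1982HodgeCycles] P. Deligne, *Hodge cycles on abelian varieties*, LNM 900 (1982), I Prop. 5.1.
* [Lange2023AbelianVarietiesComplex] H. Lange, *Abelian Varieties over the Complex Numbers*, Springer (2023),
  Thm. 2.6.5, Lemma 2.6.6, §7.2.4 Exercise (4).
-/

noncomputable section

open Module Matrix NumberField

namespace Literature.Geometry.Kaehler

namespace ComplexTorus

/-! ## §0 Frame bookkeeping: columns of `P` in a block, bases of the eigenspaces -/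

section Frame

variable {ι : Type*} [Fintype ι] [DecidableEq ι]

/-- If `M P = P B` then `M` maps the `j`-th column of `P` to `P` applied to the `j`-th column of `B`. [folklore] -/
private theorem mulVec_col_eq_of_mul_eq₆₃ {M P B : Matrix ι ι ℂ} (h : M * P = P * B) (j : ι) :
    (M *ᵥ fun k ↦ P k j) = P *ᵥ fun k ↦ B k j := by
  have h1 : (fun k ↦ P k j) = P *ᵥ Pi.single j 1 := by rw [Matrix.mulVec_single_one]; rfl
  have h2 : (fun k ↦ B k j) = B *ᵥ Pi.single j 1 := by rw [Matrix.mulVec_single_one]; rfl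
  rw [h1, h2, Matrix.mulVec_mulVec, Matrix.mulVec_mulVec, h]

omit [DecidableEq ι] in
/-- In a block-diagonal frame matrix `B = e⁻¹(diag_{w} Λ_{w})`, `P` applied to the column `e⁻¹(w, x)` of `B` is the
combination `Σ_y (Λ_w)_{yx} · P_{e⁻¹(w, y)}` of the columns of `P` in the block `w`. [folklore] -/
private theorem mulVec_col_submatrix_blockDiagonal'₆₃ {W : Type*} [Fintype W] [DecidableEq W] {n : Type*}
    [Fintype n] [DecidableEq n] (P : Matrix ι ι ℂ) (Λ : W → Matrix n n ℂ) (e : ι ≃ Σ _ : W, n) (w : W) (x : n) :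
    (P *ᵥ fun k ↦ ((Matrix.blockDiagonal' Λ).submatrix e e) k (e.symm ⟨w, x⟩)) =
      ∑ y, Λ w y x • fun k ↦ P k (e.symm ⟨w, y⟩) := by
  ext k
  simp only [Matrix.mulVec, dotProduct, Matrix.submatrix_apply, Equiv.apply_symm_apply, Finset.sum_apply,
    Pi.smul_apply, smul_eq_mul]
  rw [Fintype.sum_equiv e (fun l ↦ P k l * Matrix.blockDiagonal' Λ (e l) ⟨w, x⟩)
      (fun q ↦ P k (e.symm q) * Matrix.blockDiagonal' Λ q ⟨w, x⟩) (fun l ↦ by rw [Equiv.symm_apply_apply]),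
    Fintype.sum_sigma, Finset.sum_eq_single w]
  · simp only [Matrix.blockDiagonal'_apply_eq, mul_comm]
  · intro w' _ hw'
    simp only [Matrix.blockDiagonal'_apply_ne _ _ _ hw', mul_zero, Finset.sum_const_zero]
  · intro h
    exact absurd (Finset.mem_univ w) h

/-- Columns of an invertible matrix taken along an injective relabelling and lying in a submodule `W` are linearly
independent in `W`. [folklore] -/
private theorem linearIndependent_cols₆₃ {P : Matrix ι ι ℂ} (hP : IsUnit P.det) {W : Submodule ℂ (ι → ℂ)} {m : Type*}
    (c : m → ι) (hc : Function.Injective c) (hmem : ∀ i, (fun k ↦ P k (c i)) ∈ W) :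
    LinearIndependent ℂ fun i ↦ (⟨fun k ↦ P k (c i), hmem i⟩ : W) := by
  apply LinearIndependent.of_comp W.subtype
  have hcols : LinearIndependent ℂ P.col :=
    Matrix.linearIndependent_cols_iff_isUnit.2 ((Matrix.isUnit_iff_isUnit_det P).2 hP)
  exact hcols.comp c hc

end Frame

/-! ## §1 Remark 2.2 (b): `φ₁ : V_{σ_w} × V_{σ̄_w} → ℂ`, `(v, v') ↦ ᵗv G_ℂ v'`, is non-degenerate -/

section Pairing

variable {ι : Type*} [Fintype ι] [DecidableEq ι] {K : Type*} [Field K] [NumberField K] [IsCMField K]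
  (f : K →ₐ[ℚ] Matrix ι ι ℚ) {G : Matrix ι ι ℚ}

/-- `det G_ℂ ≠ 0`. [folklore] -/
private theorem det_map_ne_zero₆₃ (hG : G.det ≠ 0) : (G.map (algebraMap ℚ ℂ)).det ≠ 0 := by
  rw [← RingHom.mapMatrix_apply, ← RingHom.map_det]
  exact (map_ne_zero _).2 hG

/-- **«There is a nondegenerate `Ω`-bilinear form `φ₁ : V₁ × V₂ → Ω` such that `φ((x₁,x₂),(y₁,y₂)) = (φ₁(x₁,y₂),
−φ₁(x₂,y₁))`» — non-degeneracy on the `V₂` side**: for a CM field `K` acting on `ℚ^ι` through `f` and a non-degenerate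
rational `G` whose adjoint involution is complex conjugation on `f(K)` (`ᵗ(f a) G = G f(ā)`), a vector of `V_{σ̄_w}`
that is `G_ℂ`-orthogonal to all of `V_{σ_w}` vanishes: it is orthogonal to every other `V_ρ` as well («`φ|V₂ × V₂ = 0`»,
the tree's `dotProduct_mulVec_eq_zero_of_mem_iInf_eigenspace_of_ne_conjugate`), hence to `V_ℂ = ⊕_ρ V_ρ`.
[cite: Milne1999LefschetzClasses, §2 Remark 2.2 (p. 647–648)] [cite: Deligne1982HodgeCycles, I Prop. 5.1] -/
theorem eq_zero_of_mem_iInf_eigenspace_conjugate_of_forall_dotProduct_mulVec_eq_zero (hG : G.det ≠ 0)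
    (hconj : ∀ a : K, (f a)ᵀ * G = G * f (IsCMField.complexConj K a)) (w : InfinitePlace K) {v' : ι → ℂ}
    (hv' : v' ∈ ⨅ a : K, Module.End.eigenspace (Matrix.toLin' ((f a).map (algebraMap ℚ ℂ)))
      (ComplexEmbedding.conjugate w.embedding a))
    (h : ∀ v ∈ ⨅ a : K, Module.End.eigenspace (Matrix.toLin' ((f a).map (algebraMap ℚ ℂ))) (w.embedding a),
      v ⬝ᵥ (G.map (algebraMap ℚ ℂ) *ᵥ v') = 0) :
    v' = 0 := by
  classical
  have hall : ∀ x : ι → ℂ, x ⬝ᵥ (G.map (algebraMap ℚ ℂ) *ᵥ v') = 0 := fun x ↦ by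
    have hx : x ∈ ⨆ ρ : K →+* ℂ,
        (⨅ a : K, Module.End.eigenspace (Matrix.toLin' ((f a).map (algebraMap ℚ ℂ))) (ρ a)) := by
      rw [iSup_iInf_eigenspace_toLin'_map_eq_top f]; exact Submodule.mem_top
    refine Submodule.iSup_induction _ (motive := fun x ↦ x ⬝ᵥ (G.map (algebraMap ℚ ℂ) *ᵥ v') = 0) hx
      (fun ρ y hy ↦ ?_) (by rw [zero_dotProduct]) (fun y z hy hz ↦ by rw [add_dotProduct, hy, hz, add_zero])
    by_cases hρ : ρ = w.embedding
    · subst hρ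
      exact h y hy
    · refine dotProduct_mulVec_eq_zero_of_mem_iInf_eigenspace_of_ne_conjugate f hconj (fun hρ' ↦ hρ ?_) hy hv'
      rw [hρ']
      exact RingHom.ext fun a ↦ by simp
  refine Matrix.eq_zero_of_mulVec_eq_zero (det_map_ne_zero₆₃ hG) (funext fun i ↦ ?_)
  have h1 := hall (Pi.single i 1)
  rwa [single_dotProduct, one_mul] at h1

/-- **Non-degeneracy on the `V₁` side** (the mirror statement): a vector of `V_{σ_w}` that is `G_ℂ`-orthogonal to all of
`V_{σ̄_w}` vanishes. [cite: Milne1999LefschetzClasses, §2 Remark 2.2 (p. 647–648)] [cite: Deligne1982HodgeCycles, I Prop. 5.1] -/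
theorem eq_zero_of_mem_iInf_eigenspace_of_forall_dotProduct_mulVec_conjugate_eq_zero (hG : G.det ≠ 0)
    (hconj : ∀ a : K, (f a)ᵀ * G = G * f (IsCMField.complexConj K a)) (w : InfinitePlace K) {v : ι → ℂ}
    (hv : v ∈ ⨅ a : K, Module.End.eigenspace (Matrix.toLin' ((f a).map (algebraMap ℚ ℂ))) (w.embedding a))
    (h : ∀ v' ∈ ⨅ a : K, Module.End.eigenspace (Matrix.toLin' ((f a).map (algebraMap ℚ ℂ)))
      (ComplexEmbedding.conjugate w.embedding a), v ⬝ᵥ (G.map (algebraMap ℚ ℂ) *ᵥ v') = 0) :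
    v = 0 := by
  classical
  have hall : ∀ y : ι → ℂ, v ⬝ᵥ (G.map (algebraMap ℚ ℂ) *ᵥ y) = 0 := fun y ↦ by
    have hy : y ∈ ⨆ τ : K →+* ℂ,
        (⨅ a : K, Module.End.eigenspace (Matrix.toLin' ((f a).map (algebraMap ℚ ℂ))) (τ a)) := by
      rw [iSup_iInf_eigenspace_toLin'_map_eq_top f]; exact Submodule.mem_top
    refine Submodule.iSup_induction _ (motive := fun y ↦ v ⬝ᵥ (G.map (algebraMap ℚ ℂ) *ᵥ y) = 0) hy
      (fun τ y hy ↦ ?_) (by rw [Matrix.mulVec_zero, dotProduct_zero])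
      (fun y z hy hz ↦ by rw [Matrix.mulVec_add, dotProduct_add, hy, hz, add_zero])
    by_cases hτ : τ = ComplexEmbedding.conjugate w.embedding
    · subst hτ
      exact h y hy
    · refine dotProduct_mulVec_eq_zero_of_mem_iInf_eigenspace_of_ne_conjugate f hconj (fun hτ' ↦ hτ ?_) hv hy
      rw [hτ']
      exact RingHom.ext fun a ↦ by simp
  refine Matrix.eq_zero_of_vecMul_eq_zero (det_map_ne_zero₆₃ hG) (funext fun i ↦ ?_)
  have h1 := hall (Pi.single i 1)
  rwa [Matrix.dotProduct_mulVec, dotProduct_single, mul_one] at h1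

end Pairing

/-! ## §2 Remark 2.2 (c): `M ↦ (M|V_{σ_w})_w : S(X)(ℂ) ≃* ∏_{w} GL(V_{σ_w})` -/

section Torus

variable {ι : Type*} [Fintype ι] [DecidableEq ι] {E : Type*} [NormedAddCommGroup E] [NormedSpace ℂ E]
  (Φ : (ι → ℝ) ≃L[ℝ] E) {K : Type*} [Field K] [NumberField K] [IsCMField K] (f : K →ₐ[ℚ] Matrix ι ι ℚ)
  {G : Matrix ι ι ℚ}

/-- **«THEREFORE, THE MAP `α ↦ α|V₁ : U(φ)_Ω → GL(V₁)` IS AN ISOMORPHISM»**, frame-free and for every block size: for a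
complex torus `X = E/Φ(ℤ^ι)` whose rational endomorphism algebra IS the CM field `f(K)`, and an alternating
non-degenerate rational `G` whose adjoint involution is complex conjugation on `f(K)`, RESTRICTION TO THE EIGENSPACES is
an isomorphism `χ : S(X)(ℂ) ≃* ∏_{w : InfinitePlace K} GL(V_{σ_w})` onto the product of the FULL linear groups of the
`V_{σ_w} = ⨅_a Eig((f a) ⊗ 1, σ_w a)` (`σ_w = w.embedding`): `χ(M)_w v = M v` («`S(A)_{/k^al} = ∏ S_σ`,
`S_σ ≈ GL(V₁)`»; the tree's `ψ(Λ) = P · e⁻¹(diag_w Λ_w) · P⁻¹` followed by `diag(g, ᵗg⁻¹) ↦ g` and the matrix of `g` in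
the basis of `V_{σ_w}` formed by the frame columns).
[cite: Milne1999LefschetzClasses, §2 Remark 2.2 (p. 647–648), «Simple abelian variety of type IV» (p. 651) and Summary (p. 652)]
[cite: Deligne1982HodgeCycles, I Prop. 5.1] -/
theorem exists_mulEquiv_lefschetzGroupC_pi_generalLinearGroup_eigenspace (hfE : f.range = endAlgRat Φ)
    (hGt : Gᵀ = -G) (hG : G.det ≠ 0) (hconj : ∀ a : K, (f a)ᵀ * G = G * f (IsCMField.complexConj K a)) :
    ∃ χ : lefschetzGroupC Φ G ≃* ((w : InfinitePlace K) → LinearMap.GeneralLinearGroup ℂ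
        ↥(⨅ a : K, Module.End.eigenspace (Matrix.toLin' ((f a).map (algebraMap ℚ ℂ))) (w.embedding a))),
      ∀ (M : lefschetzGroupC Φ G) (w : InfinitePlace K)
        (v : ↥(⨅ a : K, Module.End.eigenspace (Matrix.toLin' ((f a).map (algebraMap ℚ ℂ))) (w.embedding a))),
        (((χ M w : _ →ₗ[ℂ] _) v : ↥(⨅ a : K, Module.End.eigenspace (Matrix.toLin' ((f a).map (algebraMap ℚ ℂ)))
            (w.embedding a))) : ι → ℂ) = ((M : SpecialLinearGroup ι ℂ) : Matrix ι ι ℂ) *ᵥ (v : ι → ℂ) := by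
  classical
  obtain ⟨n, e, P, ψ, hP, hcard, hinl, -, -, hψ⟩ :=
    exists_mulEquiv_pi_siegelLevi_lefschetzGroupC Φ f hfE hGt hG hconj
  obtain ⟨ρ, hρ⟩ := exists_mulEquiv_siegelLevi_generalLinearGroup (l := Fin n)
  set W : InfinitePlace K → Submodule ℂ (ι → ℂ) := fun w ↦
    ⨅ a : K, Module.End.eigenspace (Matrix.toLin' ((f a).map (algebraMap ℚ ℂ))) (w.embedding a) with hW
  -- bases of the `V_{σ_w}` from the frame columns `(w, inl i)`
  have hdim : ∀ w, finrank ℂ (W w) = n := fun w ↦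
    Nat.eq_of_mul_eq_mul_right finrank_pos
      ((finrank_iInf_eigenspace_toLin'_map_mul_finrank f w.embedding).trans hcard.symm)
  have hli : ∀ w, LinearIndependent ℂ fun i : Fin n ↦
      (⟨fun k ↦ P k (e.symm ⟨w, Sum.inl i⟩), hinl w i⟩ : W w) := fun w ↦
    linearIndependent_cols₆₃ hP (W := W w) (fun j : Fin n ↦ e.symm ⟨w, Sum.inl j⟩)
      (fun i j hij ↦ by simpa [Sigma.mk.inj_iff] using hij) (hinl w)
  let b : ∀ w, Basis (Fin n) ℂ (W w) := fun w ↦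
    basisOfLinearIndependentOfCardEqFinrank' _ (hli w) (by rw [Fintype.card_fin, hdim])
  have hb : ∀ w i, ((b w i : W w) : ι → ℂ) = fun k ↦ P k (e.symm ⟨w, Sum.inl i⟩) := fun w i ↦ by
    simp only [b, coe_basisOfLinearIndependentOfCardEqFinrank']
  -- `GL_n(ℂ) ≃* GL(V_{σ_w})` through the basis
  let τ : ∀ w, GL (Fin n) ℂ ≃* LinearMap.GeneralLinearGroup ℂ (W w) := fun w ↦
    Units.mapEquiv (Matrix.toLinAlgEquiv (b w)).toMulEquiv
  have hτ : ∀ w (g : GL (Fin n) ℂ), ((τ w g : LinearMap.GeneralLinearGroup ℂ (W w)) : W w →ₗ[ℂ] W w) =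
      Matrix.toLinAlgEquiv (b w) (g : Matrix (Fin n) (Fin n) ℂ) := fun w g ↦ by
    simp only [τ, Units.coe_mapEquiv]
    rfl
  refine ⟨ψ.symm.trans (MulEquiv.piCongrRight fun w ↦ ρ.trans (τ w)), fun M w v ↦ ?_⟩
  -- the blocks of `M`
  set Λ : InfinitePlace K → siegelLevi (Fin n) := ψ.symm M with hΛ
  set Λ' : InfinitePlace K → Matrix (Fin n ⊕ Fin n) (Fin n ⊕ Fin n) ℂ := fun w ↦
    ((Λ w : SpecialLinearGroup (Fin n ⊕ Fin n) ℂ) : Matrix (Fin n ⊕ Fin n) (Fin n ⊕ Fin n) ℂ) with hΛ'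
  set B : Matrix ι ι ℂ := (Matrix.blockDiagonal' Λ').submatrix e e with hB
  have hM : ((M : SpecialLinearGroup ι ℂ) : Matrix ι ι ℂ) = P * B * P⁻¹ := by
    rw [hB, hΛ', ← hψ Λ, hΛ, MulEquiv.apply_symm_apply]
  have hMP : ((M : SpecialLinearGroup ι ℂ) : Matrix ι ι ℂ) * P = P * B := by
    rw [hM]
    exact Matrix.nonsing_inv_mul_cancel_right P (P * B) hP
  obtain ⟨X, X', Y', Y, hXY⟩ : ∃ X X' Y' Y : Matrix (Fin n) (Fin n) ℂ, Λ' w = fromBlocks X X' Y' Y :=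
    ⟨_, _, _, _, (fromBlocks_toBlocks _).symm⟩
  obtain ⟨rfl, rfl, -⟩ := (mem_siegelLevi_iff hXY).1 (Λ w).2
  have hχ : (((ψ.symm.trans (MulEquiv.piCongrRight fun w ↦ ρ.trans (τ w))) M w :
      LinearMap.GeneralLinearGroup ℂ (W w)) : W w →ₗ[ℂ] W w) = Matrix.toLinAlgEquiv (b w) X := by
    rw [MulEquiv.trans_apply, MulEquiv.piCongrRight_apply, MulEquiv.trans_apply, hτ, hρ, ← hΛ]
    change Matrix.toLinAlgEquiv (b w) (Λ' w).toBlocks₁₁ = _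
    rw [hXY, toBlocks_fromBlocks₁₁]
  -- both sides are linear in `v` and agree on the basis `b w`
  suffices hlin : (W w).subtype ∘ₗ (((ψ.symm.trans (MulEquiv.piCongrRight fun w ↦ ρ.trans (τ w))) M w :
      LinearMap.GeneralLinearGroup ℂ (W w)) : W w →ₗ[ℂ] W w) =
      Matrix.toLin' ((M : SpecialLinearGroup ι ℂ) : Matrix ι ι ℂ) ∘ₗ (W w).subtype by
    have h1 := congrArg (fun L : W w →ₗ[ℂ] (ι → ℂ) ↦ L v) hlin
    simpa only [LinearMap.comp_apply, Submodule.subtype_apply, Matrix.toLin'_apply] using h1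
  refine (b w).ext fun i ↦ ?_
  rw [LinearMap.comp_apply, LinearMap.comp_apply, Submodule.subtype_apply, Submodule.subtype_apply,
    Matrix.toLin'_apply, hχ, Matrix.toLinAlgEquiv_self, Submodule.coe_sum, hb, mulVec_col_eq_of_mul_eq₆₃ hMP, hB,
    mulVec_col_submatrix_blockDiagonal'₆₃, Fintype.sum_sum_type]
  simp only [Submodule.coe_smul, hb, hXY, fromBlocks_apply₁₁, fromBlocks_apply₂₁, Matrix.zero_apply, zero_smul,
    Finset.sum_const_zero, add_zero]

/-- **An element of `S(X)(ℂ)` is determined by its restrictions to the eigenspaces `V_{σ_w}`** (the injectivity in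
«`α ↦ α|V₁` is an isomorphism»; the action on `V_{σ̄_w}` is the contragredient one). [cite: Milne1999LefschetzClasses, §2 Remark 2.2 (p. 647–648)] -/
theorem eq_of_forall_mem_iInf_eigenspace_mulVec_eq (hfE : f.range = endAlgRat Φ) (hGt : Gᵀ = -G) (hG : G.det ≠ 0)
    (hconj : ∀ a : K, (f a)ᵀ * G = G * f (IsCMField.complexConj K a)) {M M' : SpecialLinearGroup ι ℂ}
    (hM : M ∈ lefschetzGroupC Φ G) (hM' : M' ∈ lefschetzGroupC Φ G)
    (h : ∀ (w : InfinitePlace K), ∀ v ∈ ⨅ a : K, Module.End.eigenspace (Matrix.toLin' ((f a).map (algebraMap ℚ ℂ)))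
      (w.embedding a), (M : Matrix ι ι ℂ) *ᵥ v = (M' : Matrix ι ι ℂ) *ᵥ v) :
    M = M' := by
  obtain ⟨χ, hχ⟩ := exists_mulEquiv_lefschetzGroupC_pi_generalLinearGroup_eigenspace Φ f hfE hGt hG hconj
  suffices hMM : (⟨M, hM⟩ : lefschetzGroupC Φ G) = ⟨M', hM'⟩ from congrArg Subtype.val hMM
  apply χ.injective
  funext w
  refine Units.ext (LinearMap.ext fun v ↦ Subtype.ext ?_)
  rw [hχ, hχ]
  exact h w v v.2

end Torus

/-! ## §3 The polarised and the simple front-ends -/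

section Polarised

variable {ι : Type*} [Fintype ι] [DecidableEq ι] [Nonempty ι] {E : Type*} [NormedAddCommGroup E] [NormedSpace ℂ E]
  [FiniteDimensional ℂ E] {Φ : (ι → ℝ) ≃L[ℝ] E} {η : E [⋀^Fin 2]→L[ℝ] ℝ} {G : Matrix ι ι ℚ} {K : Type*} [Field K]
  [NumberField K]

omit [Nonempty ι] [FiniteDimensional ℂ E] in
/-- `End⁰(X) = f(K)` a field is commutative (for the tree's `Lf = S` criterion). [folklore] -/
private theorem endAlgRat_comm_of_range_eq₆₃' (f : K →ₐ[ℚ] Matrix ι ι ℚ) (hfE : f.range = endAlgRat Φ) :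
    ∀ a ∈ endAlgRat Φ, ∀ b ∈ endAlgRat Φ, a * b = b * a := by
  intro A hA B hB
  rw [← hfE] at hA hB
  obtain ⟨a, rfl⟩ := (AlgHom.mem_range f).1 hA
  obtain ⟨b, rfl⟩ := (AlgHom.mem_range f).1 hB
  rw [← map_mul, ← map_mul, mul_comm]

omit [FiniteDimensional ℂ E] in
/-- **REMARK 2.2 (c) FOR A POLARISED ABELIAN VARIETY WITH `End⁰(X) = f(K)` A CM FIELD: restriction to the eigenspaces is
an isomorphism `χ : S(X)(ℂ) ≃* ∏_{w : InfinitePlace K} GL(V_{σ_w})`, `χ(M)_w v = M v`** (the Rosati involution is complex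
conjugation on `K`, so §2 applies). [cite: Milne1999LefschetzClasses, §2 Remark 2.2 (p. 647–648) and «Simple abelian variety of type IV» (p. 651)]
[cite: Deligne1982HodgeCycles, I Prop. 5.1] [cite: Lange2023AbelianVarietiesComplex, Lemma 2.6.6] -/
theorem IsRiemannForm.exists_mulEquiv_lefschetzGroupC_pi_generalLinearGroup_eigenspace [IsCMField K]
    (hη : IsRiemannForm Φ η) (hG : G.map (Rat.cast : ℚ → ℝ) = latticeGram Φ η) (f : K →ₐ[ℚ] Matrix ι ι ℚ)
    (hfE : f.range = endAlgRat Φ) :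
    ∃ χ : lefschetzGroupC Φ G ≃* ((w : InfinitePlace K) → LinearMap.GeneralLinearGroup ℂ
        ↥(⨅ a : K, Module.End.eigenspace (Matrix.toLin' ((f a).map (algebraMap ℚ ℂ))) (w.embedding a))),
      ∀ (M : lefschetzGroupC Φ G) (w : InfinitePlace K)
        (v : ↥(⨅ a : K, Module.End.eigenspace (Matrix.toLin' ((f a).map (algebraMap ℚ ℂ))) (w.embedding a))),
        (((χ M w : _ →ₗ[ℂ] _) v : ↥(⨅ a : K, Module.End.eigenspace (Matrix.toLin' ((f a).map (algebraMap ℚ ℂ)))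
            (w.embedding a))) : ι → ℂ) = ((M : SpecialLinearGroup ι ℂ) : Matrix ι ι ℂ) *ᵥ (v : ι → ℂ) :=
  ComplexTorus.exists_mulEquiv_lefschetzGroupC_pi_generalLinearGroup_eigenspace Φ f hfE
    (transpose_eq_neg_of_map_ratCast Φ hG) (isUnit_det_of_map_ratCast hG hη.isUnit_det_latticeGram).ne_zero
    (hη.forall_transpose_algHom_mul_eq_complexConj hG f hfE)

omit [FiniteDimensional ℂ E] in
/-- **LANGE'S `Lf(X)(ℂ) = S(X)(ℂ)` RESTRICTED TO THE EIGENSPACES**, same setting: `χ : Lf(X)(ℂ) ≃* ∏_{w} GL(V_{σ_w})`,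
`χ(M)_w v = M v` (type IV is connected: `Lf = S` for a commutative `End⁰(X)`). [cite: Lange2023AbelianVarietiesComplex, §7.2.4 Exercise (4)]
[cite: Milne1999LefschetzClasses, §2 Remark 2.2 and Summary (p. 652: «IV ∣ GL ∣ No ∣ Yes»)] -/
theorem IsRiemannForm.exists_mulEquiv_lefschetzIdentityC_pi_generalLinearGroup_eigenspace [IsCMField K]
    (hη : IsRiemannForm Φ η) (hG : G.map (Rat.cast : ℚ → ℝ) = latticeGram Φ η) (f : K →ₐ[ℚ] Matrix ι ι ℚ)
    (hfE : f.range = endAlgRat Φ) :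
    ∃ χ : lefschetzIdentityC Φ G ≃* ((w : InfinitePlace K) → LinearMap.GeneralLinearGroup ℂ
        ↥(⨅ a : K, Module.End.eigenspace (Matrix.toLin' ((f a).map (algebraMap ℚ ℂ))) (w.embedding a))),
      ∀ (M : lefschetzIdentityC Φ G) (w : InfinitePlace K)
        (v : ↥(⨅ a : K, Module.End.eigenspace (Matrix.toLin' ((f a).map (algebraMap ℚ ℂ))) (w.embedding a))),
        (((χ M w : _ →ₗ[ℂ] _) v : ↥(⨅ a : K, Module.End.eigenspace (Matrix.toLin' ((f a).map (algebraMap ℚ ℂ)))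
            (w.embedding a))) : ι → ℂ) = ((M : SpecialLinearGroup ι ℂ) : Matrix ι ι ℂ) *ᵥ (v : ι → ℂ) := by
  have hLf : lefschetzIdentityC Φ G = lefschetzGroupC Φ G :=
    hη.lefschetzIdentityC_eq_lefschetzGroupC_of_endAlgRat_comm' hG (endAlgRat_comm_of_range_eq₆₃' f hfE)
  obtain ⟨χ, hχ⟩ := hη.exists_mulEquiv_lefschetzGroupC_pi_generalLinearGroup_eigenspace hG f hfE
  exact ⟨(MulEquiv.subgroupCongr hLf).trans χ, fun M w v ↦ hχ (MulEquiv.subgroupCongr hLf M) w v⟩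

end Polarised

section Simple

variable {κ : Type} [Fintype κ] [DecidableEq κ] [Nonempty κ] {E : Type} [NormedAddCommGroup E] [NormedSpace ℂ E]
  {Ψ : (κ → ℝ) ≃L[ℝ] E} {η : E [⋀^Fin 2]→L[ℝ] ℝ} {G : Matrix κ κ ℚ}

open Literature.RingTheory.CentralSimple (IsAlbertTypeIV) in
/-- **ALBERT TYPE IV WITH `d = 1` THROUGH THE CENTRE `K = Z(End⁰(X))`: `S(X)(ℂ) ≃* ∏_{w : InfinitePlace K} GL(V_{σ_w})` by
restriction, `χ(M)_w v = M v`**, for a SIMPLE polarised complex torus whose Rosati pair is of Albert type IV over its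
centre with `[End⁰(X) : K] = 1` («`S(A)_{/k^al} = ∏ S_σ`, `S_σ ≈ GL(V₁)`»; the eigenspaces are those of the centre,
acting through `centerField.valAlgHom`). [cite: Milne1999LefschetzClasses, §2 Remark 2.2 and «Simple abelian variety of type IV» (p. 651)]
[cite: Lange2023AbelianVarietiesComplex, Thm. 2.6.5 and §2.6.1 table] -/
theorem IsSimple.exists_mulEquiv_lefschetzGroupC_pi_generalLinearGroup_eigenspace_of_isAlbertTypeIV_of_finrank_eq_one
    (hX : IsSimple Ψ) (hη : IsRiemannForm Ψ η) (hG : G.map (Rat.cast : ℚ → ℝ) = latticeGram Ψ η)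
    (h : IsAlbertTypeIV (centerField Ψ hX) (endAlgRat Ψ) (rosatiEnd Ψ hη.1 hη.2.2 hG))
    (hd : finrank (centerField Ψ hX) (endAlgRat Ψ) = 1) :
    ∃ χ : lefschetzGroupC Ψ G ≃* ((w : InfinitePlace (centerField Ψ hX)) → LinearMap.GeneralLinearGroup ℂ
        ↥(⨅ a : centerField Ψ hX, Module.End.eigenspace
          (Matrix.toLin' ((centerField.valAlgHom Ψ hX a).map (algebraMap ℚ ℂ))) (w.embedding a))),
      ∀ (M : lefschetzGroupC Ψ G) (w : InfinitePlace (centerField Ψ hX))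
        (v : ↥(⨅ a : centerField Ψ hX, Module.End.eigenspace
          (Matrix.toLin' ((centerField.valAlgHom Ψ hX a).map (algebraMap ℚ ℂ))) (w.embedding a))),
        (((χ M w : _ →ₗ[ℂ] _) v : ↥(⨅ a : centerField Ψ hX, Module.End.eigenspace
            (Matrix.toLin' ((centerField.valAlgHom Ψ hX a).map (algebraMap ℚ ℂ))) (w.embedding a))) : κ → ℂ) =
          ((M : SpecialLinearGroup κ ℂ) : Matrix κ κ ℂ) *ᵥ (v : κ → ℂ) := by
  haveI := h.isCMField
  exact hη.exists_mulEquiv_lefschetzGroupC_pi_generalLinearGroup_eigenspace hG (centerField.valAlgHom Ψ hX)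
    (hX.range_valAlgHom_eq_endAlgRat_of_finrank_eq_one hd)

end Simple

end ComplexTorus

end Literature.Geometry.Kaehler
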